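import Mathlib.MeasureTheory.Integral.Prod
import Mathlib.Analysis.InnerProductSpace.Adjoint
import Literature.Analysis.OperatorTheory.IntegralOperatorHilbertSchmidt
import Literature.Analysis.OperatorTheory.SupNormCompactOperator
import HarnessLib

/-!
# Integral operators with bounded Hermitian kernels on a finite measure space are bounded,
# self-adjoint and compact (`RCLike` scalars, in particular `ℂ`) — PROVED

Topic `Literature/Analysis/OperatorTheory`; theorems only (no definition, no named fact, no
instance). This is the complex (indeed `RCLike 𝕜`) companion of
`PositiveKernelTransferOperator.lean`, which assembles the same package for REAL kernels on the
real Hilbert space `Lp ℝ 2 μ`. Let `(X, μ)` be a finite measure space and `K : X → X → 𝕜` a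
strongly measurable kernel bounded by `C` (`‖K x y‖ ≤ C`). The integral ("transfer") operator
`(Aφ)(x) = ∫ K(x, y) φ(y) dμ(y)` is a bounded operator on the Hilbert space `L²(X, μ) = Lp 𝕜 2 μ`;
it is compact (it is even Hilbert–Schmidt, `IntegralOperatorHilbertSchmidt.lean`), and it is
self-adjoint as soon as the kernel is HERMITIAN, `K(x, y) = conj K(y, x)` (Reed–Simon I, §VI.6,
Thm. VI.23 and the example following it). As in the real file NO definition is introduced: the
operator is delivered by an existence statement and every property is stated for ANY bounded
operator `A` agreeing a.e. with the kernel formula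
(`hA : ∀ φ, A φ =ᵐ[μ] fun x => ∫ y, K x y * φ y ∂μ`), so that the lemmas apply verbatim to
operators constructed otherwise (e.g. the transfer matrix of a lattice gauge theory realised on
`L²` of Haar measure times counting measure).

* `integral_norm_coeFn_le_sqrt_mul_norm` — `∫ ‖φ‖ dμ ≤ √μ(X) ‖φ‖₂` (`L² ⊆ L¹`, quantitative);
* `integrable_kernel_mul_coeFn_rclike`, `norm_integral_kernel_mul_le_sqrt` — the integrand
  `y ↦ K(x, y) φ(y)` is integrable and `‖∫ K(x,y) φ(y) dμ(y)‖ ≤ C √μ(X) ‖φ‖₂` (sup-norm bound);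
* `exists_kernelOp_rclike` — existence of the bounded operator with the a.e. kernel formula
  (`LinearMap.mkContinuousOfExistsBound`, tree `memLp_two_integral_kernel_mul`), and
  `eq_of_ae_kernel` — its uniqueness (`Lp.ext`);
* `inner_eq_integral_of_ae_kernel` — `⟪ψ, Aφ⟫ = ∫ conj ψ(x) (∫ K(x,y) φ(y) dμ(y)) dμ(x)`
  (`L2.inner_def`); `integrable_conj_mul_kernel_mul_coeFn` — `conj ψ(x) K(x,y) φ(y)` is integrable
  on `μ ⊗ μ`;
* `isSelfAdjoint_of_ae_hermitianKernel` — Hermitian kernel ⇒ self-adjoint operator (Fubini,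
  `integral_integral_swap`, and `integral_conj`);
* `isCompactOperator_of_ae_kernel` — bounded kernel ⇒ compact operator (the sup-norm bound and the
  tree's `isCompactOperator_of_eLpNorm_top_le`, Getz–Hahn Lemma 9.3.2; equivalently Hilbert–Schmidt);
* `exists_hermitianKernelOp_rclike` and its `𝕜 = ℂ` instance `exists_hermitianKernelOp` — the
  package: `∃ A`, kernel formula ∧ self-adjoint ∧ compact ∧ inner-product formula.

Sources: M. Reed, B. Simon, *Methods of Modern Mathematical Physics I: Functional Analysis* (1980),
§VI.6, Thm. VI.22–VI.23 [`ReedSimonI1980`]. Tree search: `PositiveKernelTransferOperator.lean`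
(real scalars only: `exists_kernelOp`, `isSelfAdjoint_kernelOp`, `isCompactOperator_kernelOp`),
`L2KernelIntegralOperator.lean` (real square-integrable kernels), `L2KernelOperator.lean` (continuous
compactly supported complex kernels on Lebesgue measure, with a `def kernelOp`); none covers a
bounded complex kernel on an abstract finite measure space. NOT here: positivity improvement /
Perron–Frobenius (real file), the Hilbert–Schmidt norm identity (`IntegralOperatorHilbertSchmidt`),
positivity of the quadratic form for positive-definite kernels.
-/

noncomputable section

open MeasureTheory Set Filter Function
open scoped InnerProductSpace ComplexConjugate ENNReal

namespace Literature.Analysis.OperatorTheory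

section RCLikeKernel

variable {𝕜 : Type*} [RCLike 𝕜] {X : Type*} [MeasurableSpace X] {μ : Measure X} [IsFiniteMeasure μ]

/-! ### `L¹ ≤ L²` on a finite measure space -/

/-- `∫ ‖φ‖ dμ ≤ √μ(X) ‖φ‖₂` for `φ ∈ L²(X, μ)`, `μ` finite (Hölder / Cauchy–Schwarz against `1`,
Mathlib's `eLpNorm_le_eLpNorm_mul_rpow_measure_univ` read in `ℝ`). [folklore] -/
theorem integral_norm_coeFn_le_sqrt_mul_norm (φ : Lp 𝕜 2 μ) :
    ∫ x, ‖φ x‖ ∂μ ≤ Real.sqrt (μ.real univ) * ‖φ‖ := by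
  have h2 : eLpNorm φ 1 μ ≤ eLpNorm φ 2 μ * μ univ ^ (1 / 2 : ℝ) := by
    have h := eLpNorm_le_eLpNorm_mul_rpow_measure_univ (p := 1) (q := 2) (μ := μ)
      one_le_two (Lp.aestronglyMeasurable φ)
    rwa [ENNReal.toReal_one, ENNReal.toReal_ofNat, div_one,
      show (1 - 1 / 2 : ℝ) = 1 / 2 by norm_num] at h
  have hne : eLpNorm φ 2 μ * μ univ ^ (1 / 2 : ℝ) ≠ ∞ :=
    ENNReal.mul_ne_top (Lp.eLpNorm_ne_top φ)
      (ENNReal.rpow_ne_top_of_nonneg (by norm_num) (measure_ne_top μ univ))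
  rw [integral_norm_eq_lintegral_enorm (Lp.aestronglyMeasurable φ), ← eLpNorm_one_eq_lintegral_enorm]
  calc (eLpNorm φ 1 μ).toReal ≤ (eLpNorm φ 2 μ * μ univ ^ (1 / 2 : ℝ)).toReal :=
        ENNReal.toReal_mono hne h2
    _ = Real.sqrt (μ.real univ) * ‖φ‖ := by
        rw [ENNReal.toReal_mul, ← ENNReal.toReal_rpow, Lp.norm_def, Real.sqrt_eq_rpow,
          measureReal_def, mul_comm]

/-! ### The integral operator of a bounded kernel on `L²` of a finite measure -/

variable {K : X → X → 𝕜} {C : ℝ}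

/-- `y ↦ K(x, y) φ(y)` is integrable for a bounded measurable kernel and `φ ∈ L²` (finite
measure: `L² ⊆ L¹`). [folklore] -/
theorem integrable_kernel_mul_coeFn_rclike (hK : StronglyMeasurable (uncurry K))
    (hC : ∀ x y, ‖K x y‖ ≤ C) (φ : Lp 𝕜 2 μ) (x : X) : Integrable (fun y => K x y * φ y) μ :=
  ((Lp.memLp φ).integrable one_le_two).bdd_mul (hK.of_uncurry_left (x := x)).aestronglyMeasurable
    (Eventually.of_forall fun y => hC x y)

/-- The sup-norm bound `‖∫ K(x,y) φ(y) dμ(y)‖ ≤ C √μ(X) ‖φ‖₂` (the tree's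
`norm_integral_kernel_mul_le` and `L² ⊆ L¹`). [folklore] -/
theorem norm_integral_kernel_mul_le_sqrt (hC : ∀ x y, ‖K x y‖ ≤ C) (hC0 : 0 ≤ C) (φ : Lp 𝕜 2 μ)
    (x : X) : ‖∫ y, K x y * φ y ∂μ‖ ≤ C * Real.sqrt (μ.real univ) * ‖φ‖ := by
  refine (norm_integral_kernel_mul_le (𝕜 := 𝕜) hC φ x).trans ?_
  rw [mul_assoc]
  exact mul_le_mul_of_nonneg_left (integral_norm_coeFn_le_sqrt_mul_norm φ) hC0

/-- **The integral operator of a bounded measurable kernel on `L²` of a finite measure space**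
(`RCLike` scalars). There is a bounded operator `A` on `L²(X, μ)` with
`(Aφ)(x) = ∫ K(x, y) φ(y) dμ(y)` for a.e. `x` (an existence statement, so that no definition is
introduced; `A` is unique, `eq_of_ae_kernel`). Reed–Simon I, Thm. VI.23 (bounded kernels on a
finite measure space are square integrable). [cite: ReedSimonI1980, Thm VI.23] -/
theorem exists_kernelOp_rclike (hK : StronglyMeasurable (uncurry K)) (hC : ∀ x y, ‖K x y‖ ≤ C) :
    ∃ A : Lp 𝕜 2 μ →L[𝕜] Lp 𝕜 2 μ,
      ∀ φ : Lp 𝕜 2 μ, (A φ : X → 𝕜) =ᵐ[μ] fun x => ∫ y, K x y * φ y ∂μ := by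
  set C' := max C 0 with hC'def
  have hC' : ∀ x y, ‖K x y‖ ≤ C' := fun x y => (hC x y).trans (le_max_left _ _)
  have hC'0 : 0 ≤ C' := le_max_right _ _
  set F : Lp 𝕜 2 μ → X → 𝕜 := fun φ x => ∫ y, K x y * φ y ∂μ with hF
  have hmem : ∀ φ, MemLp (F φ) 2 μ := fun φ => memLp_two_integral_kernel_mul hK hC φ
  have hint := fun φ x => integrable_kernel_mul_coeFn_rclike (μ := μ) hK hC φ x
  set L : Lp 𝕜 2 μ →ₗ[𝕜] Lp 𝕜 2 μ :=
    { toFun := fun φ => (hmem φ).toLp (F φ)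
      map_add' := fun φ ψ => by
        rw [← MemLp.toLp_add (hmem φ) (hmem ψ), MemLp.toLp_eq_toLp_iff]
        refine Eventually.of_forall fun x => ?_
        change F (φ + ψ) x = F φ x + F ψ x
        simp only [hF]
        rw [← integral_add (hint φ x) (hint ψ x)]
        refine integral_congr_ae ?_
        filter_upwards [Lp.coeFn_add φ ψ] with y hy
        rw [hy, Pi.add_apply, mul_add]
      map_smul' := fun c φ => by
        rw [RingHom.id_apply, ← MemLp.toLp_const_smul, MemLp.toLp_eq_toLp_iff]
        refine Eventually.of_forall fun x => ?_
        change F (c • φ) x = c • F φ x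
        simp only [hF]
        rw [smul_eq_mul, ← integral_const_mul]
        refine integral_congr_ae ?_
        filter_upwards [Lp.coeFn_smul c φ] with y hy
        rw [hy, Pi.smul_apply, smul_eq_mul]
        ring } with hL
  have hLapply : ∀ φ, L φ = (hmem φ).toLp (F φ) := fun φ => rfl
  set M : ℝ := (measureUnivNNReal μ : ℝ) ^ (2 : ℝ≥0∞).toReal⁻¹ * (C' * Real.sqrt (μ.real univ))
    with hM
  have hbound : ∀ φ, ‖L φ‖ ≤ M * ‖φ‖ := by
    intro φ
    have h1 : ∀ᵐ x ∂μ, ‖(L φ : X → 𝕜) x‖ ≤ C' * Real.sqrt (μ.real univ) * ‖φ‖ := by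
      filter_upwards [(hmem φ).coeFn_toLp] with x hx
      rw [hLapply, hx]
      exact norm_integral_kernel_mul_le_sqrt hC' hC'0 φ x
    have h2 := Lp.norm_le_of_ae_bound (by positivity) h1
    calc ‖L φ‖ ≤ (measureUnivNNReal μ : ℝ) ^ (2 : ℝ≥0∞).toReal⁻¹ *
          (C' * Real.sqrt (μ.real univ) * ‖φ‖) := h2
      _ = M * ‖φ‖ := by rw [hM]; ring
  refine ⟨L.mkContinuousOfExistsBound ⟨M, hbound⟩, fun φ => ?_⟩
  rw [LinearMap.mkContinuousOfExistsBound_apply, hLapply]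
  exact (hmem φ).coeFn_toLp

/-! ### Properties of an operator given by a kernel a.e. -/

variable {A : Lp 𝕜 2 μ →L[𝕜] Lp 𝕜 2 μ}

omit [IsFiniteMeasure μ] in
/-- An operator on `L²` is determined by an a.e. kernel formula (`Lp.ext`). [folklore] -/
theorem eq_of_ae_kernel {B : Lp 𝕜 2 μ →L[𝕜] Lp 𝕜 2 μ}
    (hA : ∀ φ : Lp 𝕜 2 μ, (A φ : X → 𝕜) =ᵐ[μ] fun x => ∫ y, K x y * φ y ∂μ)
    (hB : ∀ φ : Lp 𝕜 2 μ, (B φ : X → 𝕜) =ᵐ[μ] fun x => ∫ y, K x y * φ y ∂μ) : A = B :=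
  ContinuousLinearMap.ext fun φ => Lp.ext ((hA φ).trans (hB φ).symm)

omit [IsFiniteMeasure μ] in
/-- `⟪ψ, Aφ⟫ = ∫ conj ψ(x) (∫ K(x,y) φ(y) dμ(y)) dμ(x)` (`L2.inner_def`; Mathlib's inner product is
conjugate-linear in the first variable). [folklore] -/
theorem inner_eq_integral_of_ae_kernel
    (hA : ∀ φ : Lp 𝕜 2 μ, (A φ : X → 𝕜) =ᵐ[μ] fun x => ∫ y, K x y * φ y ∂μ) (ψ φ : Lp 𝕜 2 μ) :
    ⟪ψ, A φ⟫_𝕜 = ∫ x, conj (ψ x) * ∫ y, K x y * φ y ∂μ ∂μ := by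
  rw [L2.inner_def]
  refine integral_congr_ae ?_
  filter_upwards [hA φ] with x hx
  rw [RCLike.inner_apply', hx]

/-- The double integrand `conj ψ(x) K(x,y) φ(y)` is integrable on `μ ⊗ μ`. [folklore] -/
theorem integrable_conj_mul_kernel_mul_coeFn (hK : StronglyMeasurable (uncurry K))
    (hC : ∀ x y, ‖K x y‖ ≤ C) (ψ φ : Lp 𝕜 2 μ) :
    Integrable (fun z : X × X => conj (ψ z.1) * (K z.1 z.2 * φ z.2)) (μ.prod μ) := by
  have hψ : Integrable (fun x => conj ((ψ : X → 𝕜) x)) μ :=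
    ((Lp.memLp ψ).integrable one_le_two).mono
      (RCLike.continuous_conj.comp_aestronglyMeasurable (Lp.aestronglyMeasurable ψ))
      (Eventually.of_forall fun x => by rw [RCLike.norm_conj])
  have h1 : Integrable (fun z : X × X => conj (ψ z.1) * φ z.2) (μ.prod μ) :=
    hψ.mul_prod ((Lp.memLp φ).integrable one_le_two)
  have h2 : Integrable (fun z : X × X => uncurry K z * (conj (ψ z.1) * φ z.2)) (μ.prod μ) :=
    h1.bdd_mul hK.aestronglyMeasurable (Eventually.of_forall fun z => hC z.1 z.2)
  refine h2.congr (Eventually.of_forall fun z => ?_)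
  simp only [uncurry]
  ring

/-- **Self-adjointness**: a Hermitian kernel, `K(x, y) = conj K(y, x)`, gives a self-adjoint
operator (Fubini and `integral_conj`; Reed–Simon I, §VI.6, example after Thm. VI.23).
[cite: ReedSimonI1980, Thm VI.23] -/
theorem isSelfAdjoint_of_ae_hermitianKernel (hK : StronglyMeasurable (uncurry K))
    (hC : ∀ x y, ‖K x y‖ ≤ C) (hherm : ∀ x y, K x y = conj (K y x))
    (hA : ∀ φ : Lp 𝕜 2 μ, (A φ : X → 𝕜) =ᵐ[μ] fun x => ∫ y, K x y * φ y ∂μ) :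
    IsSelfAdjoint A := by
  rw [ContinuousLinearMap.isSelfAdjoint_iff_isSymmetric]
  intro φ ψ
  change ⟪A φ, ψ⟫_𝕜 = ⟪φ, A ψ⟫_𝕜
  refine Eq.symm ?_
  rw [← inner_conj_symm (A φ) ψ, inner_eq_integral_of_ae_kernel hA φ ψ,
    inner_eq_integral_of_ae_kernel hA ψ φ, ← integral_conj]
  -- `∫ φ̄ x ∫ K x y ψ y = ∫ conj (ψ̄ x ∫ K x y φ y)`: expand both sides as double integrals
  have h1 : ∀ x, conj ((φ : X → 𝕜) x) * ∫ y, K x y * ψ y ∂μ =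
      ∫ y, conj ((φ : X → 𝕜) x) * (K x y * ψ y) ∂μ := fun x =>
    (integral_const_mul _ _).symm
  have h2 : ∀ x, conj (conj ((ψ : X → 𝕜) x) * ∫ y, K x y * φ y ∂μ) =
      ∫ y, ψ x * (conj (K x y) * conj ((φ : X → 𝕜) y)) ∂μ := by
    intro x
    rw [map_mul, RCLike.conj_conj, ← integral_conj, ← integral_const_mul]
    refine integral_congr_ae (Eventually.of_forall fun y => ?_)
    simp only [map_mul]
  simp_rw [h1, h2]
  -- Fubini on the left, then the Hermitian symmetry pointwise
  rw [integral_integral_swap (integrable_conj_mul_kernel_mul_coeFn hK hC φ ψ)]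
  refine integral_congr_ae (Eventually.of_forall fun a => ?_)
  refine integral_congr_ae (Eventually.of_forall fun b => ?_)
  dsimp only
  rw [hherm b a]
  ring

/-- **Compactness**: a bounded kernel on a finite measure space gives a compact operator (sup-norm
bound `‖Aφ‖_∞ ≤ C √μ(X) ‖φ‖₂` and the tree's `isCompactOperator_of_eLpNorm_top_le`, Getz–Hahn's
Lemma 9.3.2; equivalently: `A` is Hilbert–Schmidt, Reed–Simon I, Thm. VI.22–VI.23).
[cite: ReedSimonI1980, Thm VI.23] -/
theorem isCompactOperator_of_ae_kernel (hC : ∀ x y, ‖K x y‖ ≤ C) (hC0 : 0 ≤ C)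
    (hA : ∀ φ : Lp 𝕜 2 μ, (A φ : X → 𝕜) =ᵐ[μ] fun x => ∫ y, K x y * φ y ∂μ) :
    IsCompactOperator A := by
  refine isCompactOperator_of_eLpNorm_top_le A (C := C * Real.sqrt (μ.real univ))
    (by positivity) fun φ => ?_
  rw [eLpNorm_exponent_top]
  refine eLpNormEssSup_le_of_ae_bound ?_
  filter_upwards [hA φ] with x hx
  rw [hx]
  exact norm_integral_kernel_mul_le_sqrt hC hC0 φ x

/-- **The integral operator of a bounded Hermitian kernel on a finite measure space** (`RCLike`
scalars) is a compact self-adjoint operator on `L²`, with `⟪ψ, Aφ⟫ = ∫ conj ψ(x) ∫ K(x,y) φ(y)`: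
the package. [cite: ReedSimonI1980, Thm VI.23] -/
theorem exists_hermitianKernelOp_rclike (hK : StronglyMeasurable (uncurry K))
    (hC : ∀ x y, ‖K x y‖ ≤ C) (hherm : ∀ x y, K x y = conj (K y x)) :
    ∃ A : Lp 𝕜 2 μ →L[𝕜] Lp 𝕜 2 μ,
      (∀ φ : Lp 𝕜 2 μ, (A φ : X → 𝕜) =ᵐ[μ] fun x => ∫ y, K x y * φ y ∂μ) ∧ IsSelfAdjoint A ∧
        IsCompactOperator A ∧
          ∀ ψ φ : Lp 𝕜 2 μ, ⟪ψ, A φ⟫_𝕜 = ∫ x, conj (ψ x) * ∫ y, K x y * φ y ∂μ ∂μ := by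
  obtain ⟨A, hA⟩ := exists_kernelOp_rclike (μ := μ) hK hC
  have hC' : ∀ x y, ‖K x y‖ ≤ max C 0 := fun x y => (hC x y).trans (le_max_left _ _)
  exact ⟨A, hA, isSelfAdjoint_of_ae_hermitianKernel hK hC hherm hA,
    isCompactOperator_of_ae_kernel hC' (le_max_right _ _) hA, inner_eq_integral_of_ae_kernel hA⟩

end RCLikeKernel

/-! ### The complex case -/

/-- **The integral operator of a bounded Hermitian complex kernel on a finite measure space**:
for `K : X → X → ℂ` strongly measurable, bounded and Hermitian (`K(x, y) = conj K(y, x)`) there is a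
bounded operator `A` on `L²(X, μ; ℂ)` with `(Aφ)(x) = ∫ K(x, y) φ(y) dμ(y)` a.e., and it is
self-adjoint and compact, with `⟪ψ, Aφ⟫ = ∫ conj ψ(x) ∫ K(x, y) φ(y) dμ(y) dμ(x)`
(`exists_hermitianKernelOp_rclike` at `𝕜 = ℂ`; Reed–Simon I, Thm. VI.23).
[cite: ReedSimonI1980, Thm VI.23] -/
theorem exists_hermitianKernelOp : ∀ {X : Type*} [MeasurableSpace X] (μ : Measure X)
    [IsFiniteMeasure μ] (K : X → X → ℂ) (C : ℝ), StronglyMeasurable (Function.uncurry K) →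
    (∀ x y, ‖K x y‖ ≤ C) → (∀ x y, K x y = (starRingEnd ℂ) (K y x)) →
    ∃ A : Lp ℂ 2 μ →L[ℂ] Lp ℂ 2 μ,
      (∀ φ : Lp ℂ 2 μ, (A φ : X → ℂ) =ᵐ[μ] fun x => ∫ y, K x y * φ y ∂μ) ∧ IsSelfAdjoint A ∧
        IsCompactOperator A ∧
          ∀ ψ φ : Lp ℂ 2 μ, ⟪ψ, A φ⟫_ℂ = ∫ x, (starRingEnd ℂ) (ψ x) * ∫ y, K x y * φ y ∂μ ∂μ := by
  intro X _ μ _ K C hK hC hherm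
  exact exists_hermitianKernelOp_rclike hK hC hherm

end Literature.Analysis.OperatorTheory

end
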